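import Mathlib
import Literature.NumberTheory.LFunctions.Zhang2022.Section15ResidueParams
import Literature.NumberTheory.LFunctions.Zhang2022.TypedSection15C
import HarnessLib

/-!
# Zhang (2022) §15 p. 88: "By Lemma 5.8, `ℛ₁* = β₁β₂L′(1,χ) + O(1/𝓛²⁴)`" (Z22:§15.u058) from Lemma 5.4 (ii)

Topic `Literature/NumberTheory/LFunctions/Zhang2022` (Landau–Siegel audit tree; verdict-neutral).
Y. Zhang, *Discrete mean estimates and the Landau–Siegel zero*, arXiv:2211.02515v1 (2022)
[Zhang2022LandauSiegel] — **an unrefereed manuscript under adjudication** (cell siegel-zhang, D-0069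
width campaign). DISCHARGE file (theorems only; no new definitions, no new facts); no statement about
Theorems 1–2 of the manuscript or about Landau–Siegel zeros is made or implied.

DAG node `Z22:§15.u058` [Z22 p.88, tex L4376–L4378] (`Typed.Section15C.Step15_u058`, L4-t3): "By
Lemma 5.8, `ℛ₁* = β₁β₂L′(1,χ) + O(1/𝓛²⁴)`", where `ℛ₁* = L(1+β₁,χ)L(1+β₂,χ)δ(1)/L′(1,χ)` (§15 p. 83,
tex L4135; `Typed.Section15A.rho1Star` = `Typed.Section15B.calR1star`, the same printed body).
Kernel-checked here (`step15_u058_of_lemma54`): for every instantiation `X : Inputs15AB` whose `ℛ₁*`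
field IS that printed body, the node follows from
* Lemma 5.8 in the tree's proved form `Lemma58.lemma_5_8_of_le` (`L(s,χ) = L′(1,χ)(s−1) + O(𝓛⁻¹⁵)`
  for `|s−1| ≤ 10α`, under (A); the skeleton node `Skeleton.Lemma58`'s lower constraint `α ≤ |s−1|`
  is not needed and indeed `|β₁| = α(1−5c′α𝓛) < α` for `c′ > 0`), applied at `s = 1+β₁`, `1+β₂`;
* Lemma 5.4 (ii), "`δ(s) = 1 + O(α log 𝓛)` for `|s−1| < 10α`" — the CLAIM node `Skeleton.Lemma54`
  (its discharge is another seat's), taken as a hypothesis and used at `s = 1`;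
* `|L′(1,χ)| ≥ c` (Lemma 5.7, tree) and `|L′(1,χ)| ≤ 2e^{9/2}(1+𝓛)𝓛` (tree), `|β₁| ≤ 2α`, `|β₂| ≤ 4α`
  (`Section15ResidueParams`).
The exact identity used: with `L(1+β_k,χ) = β_kL′ + r_k` and `δ(1) = 1 + r₃`,
`ℛ₁* − β₁β₂L′ = β₁β₂L′·r₃ + (β₁r₂ + β₂r₁)(1+r₃) + r₁r₂(1+r₃)/L′`, each term `O(𝓛⁻²⁴)` — the printed
rate is met exactly by the middle term (`α·𝓛⁻¹⁵ = π𝓛⁻²⁴`).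
-/

noncomputable section

open Complex Real Filter Topology

namespace Literature.NumberTheory.LFunctions.Zhang2022.ResidueValues

open Skeleton Typed.Section15C

variable (c' : ℝ) (X : Typed.Section15C.Inputs15AB)

/-- The algebra of `Z22:§15.u058`: with `A = β₁L + r₁`, `B = β₂L + r₂`, `d = 1 + r₃`, `L ≠ 0`,
`ABd/L − β₁β₂L = β₁β₂L·r₃ + (β₁r₂ + β₂r₁)(1+r₃) + r₁r₂(1+r₃)/L`. [cite: Zhang2022LandauSiegel, §15 p. 88] -/
theorem rstar_sub_main_eq {β₁ β₂ L r₁ r₂ r₃ : ℂ} (hL : L ≠ 0) :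
    (β₁ * L + r₁) * (β₂ * L + r₂) / L * (1 + r₃) - β₁ * β₂ * L =
      β₁ * β₂ * L * r₃ + (β₁ * r₂ + β₂ * r₁) * (1 + r₃) + r₁ * r₂ * (1 + r₃) / L := by
  field_simp
  ring

/-- **Z22:§15.u058 ⇐ Lemma 5.4 (ii) + Lemma 5.8** (§15 p. 88, tex L4376–L4378: "By Lemma 5.8,
`ℛ₁* = β₁β₂L′(1,χ) + O(1/𝓛²⁴)`"), for every instantiation `X` of the §15A/B objects whose field `ℛ₁*`
is the printed `L(1+β₁,χ)L(1+β₂,χ)δ(1)/L′(1,χ)` (both `Typed.Section15A.rho1Star` and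
`Typed.Section15B.calR1star` qualify by `rfl`). `Skeleton.Lemma54` (Lemma 5.4) is a HYPOTHESIS (CLAIM node
of §5); Lemma 5.8 is the tree theorem `Lemma58.lemma_5_8_of_le`. [cite: Zhang2022LandauSiegel, §15 p. 88] -/
theorem step15_u058_of_lemma54
    (hX : ∀ (D : ℕ) [NeZero D] (χ : DirichletCharacter ℂ D),
      X.calR1star c' χ = χ.LFunction (1 + beta1 c' D) * χ.LFunction (1 + beta2 c' D) /
        deriv χ.LFunction 1 * deltaW D 1)
    (h54 : Lemma54) : Step15_u058 c' X := by
  obtain ⟨k, C₄, h54'⟩ := h54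
  obtain ⟨c, hc, h57⟩ := norm_deriv_LFunction_one_ge
  obtain ⟨D₀, hall⟩ := h54'.and h57
  -- the constant of Lemma 5.8 with `K = 10`
  set C₈ : ℝ := 1 + 16 * Real.exp (9 / 2) * π ^ 2 * 10 ^ 2 with hC₈
  have hC₈0 : 0 ≤ C₈ := by positivity
  refine ⟨32 * Real.exp (9 / 2) * π ^ 3 * max C₄ 0 + 6 * π * C₈ * (1 + max C₄ 0 * π) +
      C₈ ^ 2 * (1 + max C₄ 0 * π) / c,
    max D₀ (max ⌈Real.exp 3⌉₊ ⌈Real.exp (14 * |c'| * π)⌉₊), fun D _ χ hD hq hp hA => ?_⟩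
  have hD₀ : D₀ ≤ D := le_trans (le_max_left _ _) hD
  obtain ⟨hL, he⟩ := thresholds c' (le_trans (le_max_right _ _) hD)
  have hℓ : 0 < ell D := by linarith
  have hℓ1 : 1 ≤ ell D := by linarith
  have hL' : 3 ≤ Real.log D := hL
  have hα := alpha_pos hL
  have hαeq := Section2.alpha_eq_pi_div_ell9 D
  obtain ⟨g54, g57⟩ := hall D χ hD₀ hq hp
  have hcL := g57 hA
  set L1 : ℂ := deriv χ.LFunction 1 with hL1
  have hN : 0 < ‖L1‖ := lt_of_lt_of_le hc hcL
  have hL0 : L1 ≠ 0 := fun h => by rw [h, norm_zero] at hN; exact lt_irrefl _ hN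
  -- Lemma 5.4 (ii) at `s = 1`
  have hδ : ‖deltaW D 1 - 1‖ ≤ max C₄ 0 * alpha D * Real.log (ell D) := by
    have h := (g54 1).2 (by rw [sub_self, norm_zero]; positivity)
    refine h.trans ?_
    have hlog : 0 ≤ Real.log (ell D) := Real.log_nonneg hℓ1
    gcongr
    exact le_max_left _ _
  -- Lemma 5.8 at `s = 1 + β₁` and `s = 1 + β₂`
  have hA' : ‖χ.LFunction 1‖ ≤ 1 / Real.log D ^ 2022 := le_of_lt hA
  have hKL : 10 * π ≤ Real.log D ^ 8 := by
    have h3 : (3 : ℝ) ^ 8 ≤ Real.log D ^ 8 := pow_le_pow_left₀ (by norm_num) hL' 8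
    nlinarith [Real.pi_lt_four]
  have hβ1 := norm_beta1_le c' hL he
  have hβ2 := norm_beta2_le c' hL he
  have hs1 : ‖(1 + beta1 c' D) - 1‖ ≤ 10 * π / Real.log D ^ 9 := by
    rw [add_sub_cancel_left]
    refine hβ1.trans ?_
    rw [hαeq, ell]; rw [mul_div_assoc']; gcongr; norm_num
  have hs2 : ‖(1 + beta2 c' D) - 1‖ ≤ 10 * π / Real.log D ^ 9 := by
    rw [add_sub_cancel_left]
    refine hβ2.trans ?_
    rw [hαeq, ell]; rw [mul_div_assoc']; gcongr; norm_num
  have hr1 := Lemma58.lemma_5_8_of_le χ hp hL' hA' hKL hs1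
  have hr2 := Lemma58.lemma_5_8_of_le χ hp hL' hA' hKL hs2
  rw [add_sub_cancel_left] at hr1 hr2
  -- the three remainders
  set r₁ : ℂ := χ.LFunction (1 + beta1 c' D) - L1 * beta1 c' D with hr₁
  set r₂ : ℂ := χ.LFunction (1 + beta2 c' D) - L1 * beta2 c' D with hr₂
  set r₃ : ℂ := deltaW D 1 - 1 with hr₃
  have hr1' : ‖r₁‖ ≤ C₈ / ell D ^ 15 := by rw [hr₁, hC₈]; exact hr1
  have hr2' : ‖r₂‖ ≤ C₈ / ell D ^ 15 := by rw [hr₂, hC₈]; exact hr2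
  have hr3' : ‖r₃‖ ≤ max C₄ 0 * alpha D * Real.log (ell D) := hδ
  -- the identity
  have hid : X.calR1star c' χ - beta1 c' D * beta2 c' D * L1 =
      beta1 c' D * beta2 c' D * L1 * r₃ + (beta1 c' D * r₂ + beta2 c' D * r₁) * (1 + r₃) +
        r₁ * r₂ * (1 + r₃) / L1 := by
    have e1 : χ.LFunction (1 + beta1 c' D) = beta1 c' D * L1 + r₁ := by rw [hr₁]; ring
    have e2 : χ.LFunction (1 + beta2 c' D) = beta2 c' D * L1 + r₂ := by rw [hr₂]; ring
    have e3 : deltaW D 1 = 1 + r₃ := by rw [hr₃]; ring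
    rw [hX D χ, e1, e2, e3]
    exact rstar_sub_main_eq hL0
  rw [hid]
  -- sizes
  have hLu : ‖L1‖ ≤ 4 * Real.exp (9 / 2) * ell D ^ 2 := by
    refine (norm_deriv_LFunction_one_le χ hL hp).trans ?_
    have h2 : (1 + ell D) * ell D ≤ 2 * ell D ^ 2 := by nlinarith
    have h3 := mul_le_mul_of_nonneg_left h2 (by positivity : (0 : ℝ) ≤ 2 * Real.exp (9 / 2))
    calc 2 * Real.exp (9 / 2) * (1 + ell D) * ell D = 2 * Real.exp (9 / 2) * ((1 + ell D) * ell D) := by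
          ring
      _ ≤ 2 * Real.exp (9 / 2) * (2 * ell D ^ 2) := h3
      _ = 4 * Real.exp (9 / 2) * ell D ^ 2 := by ring
  have hlogℓ : Real.log (ell D) ≤ ell D := (Real.log_le_sub_one_of_pos hℓ).trans (by linarith)
  have hlog0 : 0 ≤ Real.log (ell D) := Real.log_nonneg hℓ1
  have hαℓ9 : alpha D * ell D ^ 9 = π := by rw [hαeq]; field_simp
  have hαlog : alpha D * Real.log (ell D) ≤ π := by
    calc alpha D * Real.log (ell D) ≤ alpha D * ell D ^ 9 := by
          refine mul_le_mul_of_nonneg_left (hlogℓ.trans ?_) hα.le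
          calc ell D = ell D ^ 1 := (pow_one _).symm
            _ ≤ ell D ^ 9 := pow_le_pow_right₀ hℓ1 (by norm_num)
      _ = π := hαℓ9
  have h1r3 : ‖1 + r₃‖ ≤ 1 + max C₄ 0 * π := by
    refine (norm_add_le _ _).trans ?_
    rw [norm_one]
    have : ‖r₃‖ ≤ max C₄ 0 * π := hr3'.trans (by
      rw [mul_assoc]; exact mul_le_mul_of_nonneg_left hαlog (le_max_right _ _))
    linarith
  -- term 1: `|β₁β₂L′ r₃| ≤ 32 e^{9/2} π³ C₄ / 𝓛²⁴`
  have T1 : ‖beta1 c' D * beta2 c' D * L1 * r₃‖ ≤ 32 * Real.exp (9 / 2) * π ^ 3 * max C₄ 0 / ell D ^ 24 := by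
    rw [norm_mul, norm_mul, norm_mul]
    calc ‖beta1 c' D‖ * ‖beta2 c' D‖ * ‖L1‖ * ‖r₃‖
        ≤ (2 * alpha D) * (4 * alpha D) * (4 * Real.exp (9 / 2) * ell D ^ 2) *
            (max C₄ 0 * alpha D * Real.log (ell D)) := by gcongr
      _ ≤ (2 * alpha D) * (4 * alpha D) * (4 * Real.exp (9 / 2) * ell D ^ 2) *
            (max C₄ 0 * alpha D * ell D) := by gcongr
      _ = 32 * Real.exp (9 / 2) * max C₄ 0 * (alpha D * ell D ^ 9) ^ 3 / ell D ^ 24 := by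
          field_simp; ring
      _ = 32 * Real.exp (9 / 2) * π ^ 3 * max C₄ 0 / ell D ^ 24 := by rw [hαℓ9]; ring
  -- term 2: `|(β₁r₂ + β₂r₁)(1+r₃)| ≤ 6π C₈ (1 + C₄π) / 𝓛²⁴`
  have T2 : ‖(beta1 c' D * r₂ + beta2 c' D * r₁) * (1 + r₃)‖ ≤
      6 * π * C₈ * (1 + max C₄ 0 * π) / ell D ^ 24 := by
    rw [norm_mul]
    have hsum : ‖beta1 c' D * r₂ + beta2 c' D * r₁‖ ≤ 6 * alpha D * (C₈ / ell D ^ 15) := by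
      refine (norm_add_le _ _).trans ?_
      rw [norm_mul, norm_mul]
      have i1 : ‖beta1 c' D‖ * ‖r₂‖ ≤ 2 * alpha D * (C₈ / ell D ^ 15) :=
        mul_le_mul hβ1 hr2' (norm_nonneg _) (by positivity)
      have i2 : ‖beta2 c' D‖ * ‖r₁‖ ≤ 4 * alpha D * (C₈ / ell D ^ 15) :=
        mul_le_mul hβ2 hr1' (norm_nonneg _) (by positivity)
      linarith
    calc ‖beta1 c' D * r₂ + beta2 c' D * r₁‖ * ‖1 + r₃‖
        ≤ 6 * alpha D * (C₈ / ell D ^ 15) * (1 + max C₄ 0 * π) :=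
          mul_le_mul hsum h1r3 (norm_nonneg _) (by positivity)
      _ = 6 * C₈ * (1 + max C₄ 0 * π) * (alpha D * ell D ^ 9) / ell D ^ 24 := by
          field_simp
      _ = 6 * π * C₈ * (1 + max C₄ 0 * π) / ell D ^ 24 := by rw [hαℓ9]; ring
  -- term 3: `|r₁r₂(1+r₃)/L′| ≤ C₈²(1+C₄π)/(c 𝓛³⁰) ≤ C₈²(1+C₄π)/(c 𝓛²⁴)`
  have T3 : ‖r₁ * r₂ * (1 + r₃) / L1‖ ≤ C₈ ^ 2 * (1 + max C₄ 0 * π) / c / ell D ^ 24 := by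
    rw [norm_div, norm_mul, norm_mul]
    have hnum : ‖r₁‖ * ‖r₂‖ * ‖1 + r₃‖ ≤ (C₈ / ell D ^ 15) * (C₈ / ell D ^ 15) * (1 + max C₄ 0 * π) := by
      have i1 : ‖r₁‖ * ‖r₂‖ ≤ (C₈ / ell D ^ 15) * (C₈ / ell D ^ 15) :=
        mul_le_mul hr1' hr2' (norm_nonneg _) (by positivity)
      exact mul_le_mul i1 h1r3 (norm_nonneg _) (by positivity)
    calc ‖r₁‖ * ‖r₂‖ * ‖1 + r₃‖ / ‖L1‖
        ≤ (C₈ / ell D ^ 15) * (C₈ / ell D ^ 15) * (1 + max C₄ 0 * π) / c := by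
          exact div_le_div₀ (by positivity) hnum hc hcL
      _ = C₈ ^ 2 * (1 + max C₄ 0 * π) / c / ell D ^ 30 := by field_simp
      _ ≤ C₈ ^ 2 * (1 + max C₄ 0 * π) / c / ell D ^ 24 := by
          refine div_le_div_of_nonneg_left (by positivity) (by positivity) ?_
          exact pow_le_pow_right₀ hℓ1 (by norm_num)
  calc ‖beta1 c' D * beta2 c' D * L1 * r₃ + (beta1 c' D * r₂ + beta2 c' D * r₁) * (1 + r₃) +
        r₁ * r₂ * (1 + r₃) / L1‖
      ≤ ‖beta1 c' D * beta2 c' D * L1 * r₃‖ + ‖(beta1 c' D * r₂ + beta2 c' D * r₁) * (1 + r₃)‖ +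
        ‖r₁ * r₂ * (1 + r₃) / L1‖ := by
          refine (norm_add_le _ _).trans ?_
          gcongr
          exact norm_add_le _ _
    _ ≤ 32 * Real.exp (9 / 2) * π ^ 3 * max C₄ 0 / ell D ^ 24 +
        6 * π * C₈ * (1 + max C₄ 0 * π) / ell D ^ 24 +
        C₈ ^ 2 * (1 + max C₄ 0 * π) / c / ell D ^ 24 := by linarith
    _ = _ := by rw [add_div, add_div]

end Literature.NumberTheory.LFunctions.Zhang2022.ResidueValues
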